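import Summits.Ventures.YMGap.RobustBall.MassGapOnBallZdG
import Summits.Ventures.YMGap.RobustBall.WindowTiltDefect
import HarnessLib

/-!
# Venture YMGap, track ROBUST-BALL (Y2) — the loads a member of ds-2's gauge-invariant ball carries as a DIRECTION: total Lipschitz load `≤ ε₁`
# through every link, window load `≤ 2d·ε₀` on every vertex star

HONEST FRAMING. WHAT THIS IS: a venture file (cell `pub-ymgap`, track Y2 ROBUST-BALL, seat rb-p1, theorems only): bookkeeping that turns the
membership `(V, suppV) ∈ MemBallZdG ε₀ ε₁ R` into the two direction hypotheses of the derivative files (`DirectionalSusceptibility*`,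
`StateDerivative*`): with witnesses switched off on inactive terms and cut down to the term's own links,
* `card_starWinZd_le` — a vertex star window has at most `2d` links;
* `MemBallZdG.exists_lipLoad` — Frobenius-Lipschitz witnesses `lipV` with `X ↦ [e ∈ X]·Σ_{y∈X} lipV X y` summable and `Σ' ≤ ε₁` for every link `e`;
* `MemBallZdG.exists_oscWindowLoad` — oscillation witnesses `oscV` with `windowLoad d suppV oscV (starWinZd c) ≤ 2d·ε₀` for every `c`.
WHAT THIS IS NOT: anything about states; pure bookkeeping; nothing about the continuum limit or a Clay-sense mass gap.
-/

noncomputable section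

open MeasureTheory Function Finset Real
open Literature.Probability.LatticeModels
open Literature.Probability.LatticeModels.DobrushinMetric
open Literature.MathematicalPhysics.QuantumLattice
open Literature.MathematicalPhysics.QuantumFieldTheory hiding ZdEdge
open Summit.Ventures.YMGap.DSWindowZd

namespace Summit.Ventures.YMGap.RobustBall

variable {d N : ℕ}

/-- A vertex star window has at most `2d` links. -/
theorem card_starWinZd_le (c : ZdEdge d) : (starWinZd c).card ≤ 2 * d := by
  classical
  unfold starWinZd vertexStarZd
  refine (Finset.card_union_le _ _).trans ?_
  have h1 := Finset.card_image_le (s := (Finset.univ : Finset (Fin d))) (f := fun μ : Fin d => ((c.1, μ) : ZdEdge d))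
  have h2 := Finset.card_image_le (s := (Finset.univ : Finset (Fin d))) (f := fun μ : Fin d => ((c.1 - Pi.single μ 1, μ) : ZdEdge d))
  rw [Finset.card_univ, Fintype.card_fin] at h1 h2
  omega

section Loads

variable {ε₀ ε₁ : ℝ} {R : ℕ} {V : Potential (ZdEdge d) (SUN N)} {suppV : Finset (ZdEdge d) → Finset (Finset (ZdEdge d))}

/-- **A member of the gauge-invariant ball is a direction of total Lipschitz load `≤ ε₁` through every link** (witnesses switched off on inactive
terms and cut down to the term's own links; the load series is a finite sum over the listed sets through the link). -/
theorem MemBallZdG.exists_lipLoad (hV : MemBallZdG ε₀ ε₁ R V suppV) :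
    ∃ lipV : Finset (ZdEdge d) → ZdEdge d → ℝ, (∀ X, IsLipBound suFrobDist (V X) (lipV X)) ∧
      (∀ e, Summable fun X : Finset (ZdEdge d) => (if e ∈ X then ∑ y ∈ X, lipV X y else 0)) ∧
      ∀ e, ∑' X : Finset (ZdEdge d), (if e ∈ X then ∑ y ∈ X, lipV X y else 0) ≤ ε₁ := by
  classical
  obtain ⟨osc, lip, -, hlip, -, hε₁⟩ := hV.loads
  set lipV : Finset (ZdEdge d) → ZdEdge d → ℝ := fun X y => if V X = 0 then 0 else if y ∈ X then lip X y else 0 with hlipV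
  have hlb : ∀ X, IsLipBound suFrobDist (V X) (lipV X) := fun X => by
    by_cases h0 : V X = 0
    · refine ⟨fun y => by simp only [hlipV, if_pos h0]; exact le_rfl, fun y σ τ _ => ?_⟩
      simp only [hlipV, if_pos h0, h0, Pi.zero_apply, sub_self, abs_zero, zero_mul]; exact le_rfl
    · have h := (hlip X).restrict (hV.dependsOn X)
      refine ⟨fun y => ?_, fun y σ τ hστ => ?_⟩
      · simp only [hlipV, if_neg h0]; exact h.nonneg y
      · simp only [hlipV, if_neg h0]; exact h.le y σ τ hστ
  have hnn : ∀ X y, 0 ≤ lipV X y := fun X y => (hlb X).nonneg y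
  set g : ZdEdge d → Finset (ZdEdge d) → ℝ := fun e X => if e ∈ X then ∑ y ∈ X, lipV X y else 0 with hg
  -- the support of `g e` is contained in the listed sets through `e`
  have hsupp : ∀ e X, g e X ≠ 0 → X ∈ (suppV {e}).filter (fun X => e ∈ X) := by
    intro e X hX
    simp only [hg] at hX
    by_cases he : e ∈ X
    · rw [if_pos he] at hX
      have hV0 : V X ≠ 0 := fun h0 => hX (Finset.sum_eq_zero fun y _ => by simp only [hlipV, if_pos h0])
      exact Finset.mem_filter.2 ⟨hV.supportedBy {e} X ⟨e, Finset.mem_inter.2 ⟨he, Finset.mem_singleton_self e⟩⟩ hV0, he⟩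
    · exact (hX (if_neg he)).elim
  have hsum : ∀ e, Summable (g e) := fun e =>
    summable_of_ne_finset_zero (s := (suppV {e}).filter (fun X => e ∈ X)) fun X hX => by
      by_contra h; exact hX (hsupp e X h)
  refine ⟨lipV, hlb, hsum, fun e => ?_⟩
  have hg0 : ∀ X, 0 ≤ g e X := fun X => by simp only [hg]; split_ifs; exacts [Finset.sum_nonneg fun y _ => hnn X y, le_rfl]
  rw [tsum_eq_sum (s := (suppV {e}).filter (fun X => e ∈ X)) (fun X hX => by by_contra h; exact hX (hsupp e X h))]
  calc ∑ X ∈ (suppV {e}).filter (fun X => e ∈ X), g e X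
      ≤ ∑ X ∈ (suppV {e}).filter (fun X => e ∈ X), ∑ y ∈ X, lip X y := by
        refine Finset.sum_le_sum fun X _ => ?_
        simp only [hg]
        split_ifs with he
        · refine Finset.sum_le_sum fun y hy => ?_
          simp only [hlipV]; split_ifs
          · exact (hlip X).nonneg y
          · exact le_rfl
        · exact Finset.sum_nonneg fun y _ => (hlip X).nonneg y
    _ ≤ ∑ X ∈ listedAt suppV e.1, ∑ y ∈ X, lip X y :=
        Finset.sum_le_sum_of_subset_of_nonneg (filter_supp_subset_listedAt suppV e) fun X _ _ => Finset.sum_nonneg fun y _ => (hlip X).nonneg y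
    _ ≤ ε₁ := hε₁ e.1

/-- **A member of the gauge-invariant ball is a direction of window load `≤ 2d·ε₀` on every vertex star** (witnesses switched off on inactive
terms and cut down to the term's own links). -/
theorem MemBallZdG.exists_oscWindowLoad (hV : MemBallZdG ε₀ ε₁ R V suppV) :
    ∃ oscV : Finset (ZdEdge d) → ZdEdge d → ℝ, (∀ X, Dobrushin.IsOscBound (V X) (oscV X)) ∧
      ∀ c : ZdEdge d, windowLoad d suppV oscV (starWinZd c) ≤ 2 * d * ε₀ := by
  classical
  obtain ⟨osc, lip, hosc, -, hε₀, -⟩ := hV.loads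
  set oscV : Finset (ZdEdge d) → ZdEdge d → ℝ := fun X x => if V X = 0 then 0 else if x ∈ X then osc X x else 0 with hoscV
  have hob : ∀ X, Dobrushin.IsOscBound (V X) (oscV X) := fun X => by
    by_cases h0 : V X = 0
    · refine ⟨fun y => by simp only [hoscV, if_pos h0]; exact le_rfl, fun y σ τ _ => ?_⟩
      simp only [hoscV, if_pos h0, h0, Pi.zero_apply, sub_self, abs_zero]; exact le_rfl
    · refine ⟨fun y => ?_, fun y σ τ hστ => ?_⟩
      · simp only [hoscV, if_neg h0]; split_ifs; exacts [(hosc X).nonneg y, le_rfl]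
      · simp only [hoscV, if_neg h0]
        split_ifs with hy
        · exact (hosc X).le y σ τ hστ
        · -- `y ∉ X`: `V X` does not see the difference
          have hστ' : ∀ z ∈ (↑X : Set (ZdEdge d)), σ z = τ z := fun z hz => hστ z fun hzy => hy (hzy ▸ Finset.mem_coe.1 hz)
          rw [hV.dependsOn X hστ', sub_self, abs_zero]
  have hnn : ∀ X x, 0 ≤ oscV X x := fun X x => (hob X).nonneg x
  have hle : ∀ X x, oscV X x ≤ osc X x := fun X x => by
    simp only [hoscV]; split_ifs; exacts [(hosc X).nonneg x, le_rfl, (hosc X).nonneg x]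
  refine ⟨oscV, hob, fun c => ?_⟩
  have hε₀0 : 0 ≤ ε₀ := le_trans (Finset.sum_nonneg fun X _ => (hosc X).nonneg _) (hε₀ c)
  -- per link `x` of the window: only active terms through `x` contribute, and they are listed in `suppV {x}`
  have hx : ∀ (P : Finset (ZdEdge d)) (x : ZdEdge d), ∑ A ∈ (suppV P).filter (fun A => (A ∩ P).Nonempty), oscV A x ≤ ε₀ := by
    intro P x
    rw [← Finset.sum_filter_ne_zero]
    calc ∑ A ∈ ((suppV P).filter (fun A => (A ∩ P).Nonempty)).filter (fun A => oscV A x ≠ 0), oscV A x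
        ≤ ∑ A ∈ (suppV {x}).filter (fun A => x ∈ A), oscV A x := by
          refine Finset.sum_le_sum_of_subset_of_nonneg (fun A hA => ?_) fun A _ _ => hnn A x
          have hne := (Finset.mem_filter.1 hA).2
          have hV0 : V A ≠ 0 := fun h0 => hne (by simp only [hoscV, if_pos h0])
          have hxA : x ∈ A := by by_contra hxA; exact hne (by simp only [hoscV, if_neg hV0, if_neg hxA])
          exact Finset.mem_filter.2 ⟨hV.supportedBy {x} A ⟨x, Finset.mem_inter.2 ⟨hxA, Finset.mem_singleton_self x⟩⟩ hV0, hxA⟩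
      _ ≤ ∑ A ∈ (suppV {x}).filter (fun A => x ∈ A), osc A x := Finset.sum_le_sum fun A _ => hle A x
      _ ≤ ε₀ := hε₀ x
  unfold windowLoad
  calc ∑ x ∈ starWinZd c, ∑ A ∈ (suppV (starWinZd c)).filter (fun A => (A ∩ starWinZd c).Nonempty), oscV A x
      ≤ ∑ x ∈ starWinZd c, ε₀ := Finset.sum_le_sum fun x _ => hx _ x
    _ = (starWinZd c).card * ε₀ := by rw [Finset.sum_const, nsmul_eq_mul]
    _ ≤ 2 * d * ε₀ := by
        have h := card_starWinZd_le c
        exact mul_le_mul_of_nonneg_right (by exact_mod_cast h) hε₀0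

end Loads

end Summit.Ventures.YMGap.RobustBall

end
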